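import Summits.AtomisticToContinuum.Crystallization.Theorems.ChartedZeroExcessLayeredLatticeLiouvilleZZZYI
import Summits.AtomisticToContinuum.Crystallization.Theorems.ChartedZeroExcessLayeredLatticeLiouvilleZZZNA

/-!
# ChartedZeroExcess · LayeredLatticeLiouville ZZZYJ (lens-2 g94 NODE 94 «HessianChord», PART A) — THE SECOND-ORDER TABLE OF THE LENNARD-JONES BOND AND
# WINDOW-PIN: THE SIGN TABLE OF THE SOFT CONE (all PROVED).
Docket `stmt-AtomisticToContinuum-26636` (crux `ChartedZeroExcessLayered`), W2 line; residual of record after g93 (critic r1643 (B)): (X1ᴸ′), (X2ᴸ′), (KAᴸ′),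
(BCᴸ′) `SoftBregmanCoerciveP … c`, (OGʰ′⋆), door `mildCoherentMoatCorePG_W2h` (tree ZZZYI).  NODE 94 cuts (BCᴸ′) into the chord calculus (C2ᴸ) and the
stability of the clamped pre-stressed Hessian form along soft chords (HSᴸ) (PART B, file ZZZYK: pieces, glue PROVED, door W2i).  THIS FILE (all PROVED, 0 sorry):
* (E) THE SECOND-ORDER TABLE: `ljSecondDeriv = V''` (`hasDerivAt_ljDeriv`), its sign about the inflection `r⋆⁶ = 13/7` (`ljSecondDeriv_pos/neg`), the sign of the tension
  (`ljDeriv_pos_of_one_lt`, `ljDeriv_neg_of_lt_one`), the HESSIAN OF ONE BOND `bondHess b v = V''(ℓ)(u·v)² + (V'(ℓ)/ℓ)(‖v‖² − (u·v)²)` — longitudinal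
  stiffness plus TRANSVERSE PRE-STRESS with the sign of the tension — nonnegative in every direction on a stretched convex bond (`bondHess_nonneg_of_stretched`),
  bounded below on a compressed one (`bondHess_ge_of_compressed`), and the CLAMPED HESSIAN FORM `clampedHessForm X z w` (pair double sum + frozen-exterior sum): the
  matrix «H» of CRITIC-LEDGER row 1643 (c).
* (W) WINDOW-PIN — r1643's first deliverable — PROVED FROM THE TREE: the labels of two distinct core atoms are `σ`-separated crystal sites, EITHER a
  nearest-neighbour-type pair `dist ≤ 17/16 + 2·10⁻⁴` (tree `placedCrystal_gap`) OR far `6/5 ≤ dist` (gap exclusion at the `(1/15, 8999/10000, 1)` window of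
  tree `layeredHom_good_of_shadow_sigma`, transported to the placed crystal at every `σ > 2·10⁻⁴`: `placedCrystal_good_sigma`) — `label_pair_dichotomy`;
  along a filling `y` of the inner tube (`sb₁`) and a `τ`-soft `z` the windows move by `≤ sb₁ + τ` (`soft_bond_dichotomy`), so at the record
  (`σ = 27/32`, `sb₁ ≤ 249/20000`, `τ = 249/10000`) NO SOFT BOND SITS AT THE INFLECTION `r⋆ ≈ 1.1087`: nearest-neighbour-type soft bonds have length
  `≤ 1.10005` (`V'' > 0`), far ones `≥ 1.16265` (`V' > 0`, `V'' < 0`) — `soft_bond_sign_record`.  Per-bond stretch `17/16` IS admissible (uniaxial `6.25 %`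
  along one bond direction is clean and Nash): g92/g93's isotropic corner `1.075–1.08` is excluded, the live thin corner is UNIAXIAL.
0 sorry · imports = tree ZZZYI + tree ZZZNA (`isTwoShellGoodSet_placed`) · 3 defs (`ljSecondDeriv`, `bondHess`, `clampedHessForm`), 17 theorems · no instances/notation/options
· axioms standard. [g94]
-/

noncomputable section
open scoped BigOperators Classical InnerProductSpace RealInnerProductSpace
open MeasureTheory Set Metric Filter Topology
open Literature.MathematicalPhysics.StatisticalMechanics (lennardJones)
open Literature.Geometry.DiscreteGeometry (IsTwoShellGoodSet)

namespace Summit.AtomisticToContinuum.Crystallization.Theorems.ChartedZeroExcessLayeredLatticeLiouville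

open Summit.AtomisticToContinuum.Crystallization.Theorems.ChartedPlanarOrderRigidityDoor (E3 IsClean)
open Summit.AtomisticToContinuum.Crystallization.Theorems.ChartedPlanarOrderDensityDichotomy (μS IsSep)
open Summit.AtomisticToContinuum.Crystallization.Theorems.ChartedPlanarOrderCleanScaleP (IsCleanP IsDoorSetP)
open Summit.AtomisticToContinuum.Crystallization.Theorems.ChartedPlanarOrderMesoCut (LayeredHom EnvClose)
open Summit.AtomisticToContinuum.Crystallization.Theorems.ChartedPlanarOrderDoorLayeredOsc (IsTwoShellAffineGood)
open Summit.AtomisticToContinuum.Crystallization.Theorems.ChartedPlanarOrderNashForceBalance (ljDeriv pairDeriv)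

/-! ### ZZZYJ-1  (E) The second derivative of `V_LJ`, the Hessian of one bond and the clamped Hessian form (calculus and algebra, PROVED) -/

section SecondOrder

/-- ★ **`ljSecondDeriv r = 13 r⁻¹⁴ − 7 r⁻⁸`** — the second-derivative table of the tree's Lennard-Jones potential `V_LJ(r) = r⁻¹²/12 − r⁻⁶/6` (first table
`ljDeriv r = −r⁻¹³ + r⁻⁷`, tree N-force-balance): positive iff `r⁶ < 13/7`, i.e. below the INFLECTION `r⋆ = (13/7)^{1/6} ≈ 1.1087`; `ljSecondDeriv 1 = 6`. [this file, g94] -/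
def ljSecondDeriv (r : ℝ) : ℝ := 13 * (r⁻¹) ^ 14 - 7 * (r⁻¹) ^ 8

/-- `ljDeriv` is differentiable away from `0` with derivative `ljSecondDeriv` — so `ljSecondDeriv = V_LJ''`. [this file, g94] -/
theorem hasDerivAt_ljDeriv {r : ℝ} (hr : r ≠ 0) : HasDerivAt ljDeriv (ljSecondDeriv r) r := by
  have hinv : HasDerivAt (fun y : ℝ => y⁻¹) (-(r ^ 2)⁻¹) r := hasDerivAt_inv hr
  have h13 := ((hasDerivAt_pow 13 r⁻¹).comp r hinv).neg
  have h7 := (hasDerivAt_pow 7 r⁻¹).comp r hinv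
  have h := h13.add h7
  refine (h.congr_of_eventuallyEq (Eventually.of_forall fun y => ?_)).congr_deriv ?_
  · simp [ljDeriv, Function.comp]
  · simp only [ljSecondDeriv, ← inv_pow]
    ring

/-- below the inflection `V_LJ'' > 0` (`0 < r`, `r⁶ < 13/7`). [this file, g94] -/
theorem ljSecondDeriv_pos {r : ℝ} (hr : 0 < r) (h : r ^ 6 < 13 / 7) : 0 < ljSecondDeriv r := by
  have hi : 0 < r⁻¹ := inv_pos.2 hr
  have h8 : 0 < (r⁻¹) ^ 8 := pow_pos hi 8
  have h6 : 7 / 13 < (r⁻¹) ^ 6 := by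
    rw [inv_pow, lt_inv_comm₀ (by norm_num) (pow_pos hr 6)]
    have e : (7 / 13 : ℝ)⁻¹ = 13 / 7 := by norm_num
    rw [e]; exact h
  have e14 : (r⁻¹) ^ 14 = (r⁻¹) ^ 8 * (r⁻¹) ^ 6 := by ring
  unfold ljSecondDeriv
  rw [e14]
  nlinarith [mul_pos h8 (show (0 : ℝ) < 13 * (r⁻¹) ^ 6 - 7 by linarith)]

/-- beyond the inflection `V_LJ'' < 0` (`0 < r`, `13/7 < r⁶`). [this file, g94] -/
theorem ljSecondDeriv_neg {r : ℝ} (hr : 0 < r) (h : 13 / 7 < r ^ 6) : ljSecondDeriv r < 0 := by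
  have hi : 0 < r⁻¹ := inv_pos.2 hr
  have h8 : 0 < (r⁻¹) ^ 8 := pow_pos hi 8
  have h6 : (r⁻¹) ^ 6 < 7 / 13 := by
    rw [inv_pow, inv_lt_comm₀ (pow_pos hr 6) (by norm_num)]
    have e : (7 / 13 : ℝ)⁻¹ = 13 / 7 := by norm_num
    rw [e]; exact h
  have e14 : (r⁻¹) ^ 14 = (r⁻¹) ^ 8 * (r⁻¹) ^ 6 := by ring
  unfold ljSecondDeriv
  rw [e14]
  nlinarith [mul_pos h8 (show (0 : ℝ) < 7 - 13 * (r⁻¹) ^ 6 by linarith)]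

/-- a stretched bond is in TENSION: `V_LJ' > 0` for `1 < r`. [this file, g94] -/
theorem ljDeriv_pos_of_one_lt {r : ℝ} (h : 1 < r) : 0 < ljDeriv r := by
  have hr : 0 < r := by linarith
  have hi : 0 < r⁻¹ := inv_pos.2 hr
  have hi1 : r⁻¹ < 1 := inv_lt_one_of_one_lt₀ h
  have h7 : 0 < (r⁻¹) ^ 7 := pow_pos hi 7
  have h6 : (r⁻¹) ^ 6 < 1 := pow_lt_one₀ hi.le hi1 (by norm_num)
  have e13 : (r⁻¹) ^ 13 = (r⁻¹) ^ 7 * (r⁻¹) ^ 6 := by ring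
  unfold ljDeriv
  rw [e13]
  nlinarith [mul_pos h7 (show (0 : ℝ) < 1 - (r⁻¹) ^ 6 by linarith)]

/-- a compressed bond is in COMPRESSION: `V_LJ' < 0` for `0 < r < 1`. [this file, g94] -/
theorem ljDeriv_neg_of_lt_one {r : ℝ} (hr : 0 < r) (h : r < 1) : ljDeriv r < 0 := by
  have hi : 0 < r⁻¹ := inv_pos.2 hr
  have hi1 : 1 < r⁻¹ := (one_lt_inv₀ hr).2 h
  have h7 : 0 < (r⁻¹) ^ 7 := pow_pos hi 7
  have h6 : 1 < (r⁻¹) ^ 6 := one_lt_pow₀ hi1 (by norm_num)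
  have e13 : (r⁻¹) ^ 13 = (r⁻¹) ^ 7 * (r⁻¹) ^ 6 := by ring
  unfold ljDeriv
  rw [e13]
  nlinarith [mul_pos h7 (show (0 : ℝ) < (r⁻¹) ^ 6 - 1 by linarith)]

/-- ★ **`bondHess b v` — THE HESSIAN OF ONE BOND**: the second derivative at `t = 0` of `t ↦ V_LJ ‖b + t•v‖` (`b ≠ 0`), split into its LONGITUDINAL part
`V''(ℓ)·(u·v)²` and its TRANSVERSE (pre-stress) part `(V'(ℓ)/ℓ)·(‖v‖² − (u·v)²)`, `ℓ = ‖b‖`, `u = b/ℓ`.  The transverse coefficient carries the SIGN OF THE BOND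
TENSION: negative on compressed bonds (`ℓ < 1`: `ljDeriv_neg_of_lt_one`) — on the soft window these are the ONLY negative nearest-neighbour entries of the
clamped Hessian (rotating a compressed bond lowers the energy to second order) — positive on stretched ones.  (Junk value at `b = 0`, never used.) [this file, g94] -/
def bondHess (b v : E3) : ℝ := ljSecondDeriv ‖b‖ * (⟪b, v⟫ / ‖b‖) ^ 2 + ljDeriv ‖b‖ / ‖b‖ * (‖v‖ ^ 2 - (⟪b, v⟫ / ‖b‖) ^ 2)

/-- the longitudinal component is at most the full length (Cauchy–Schwarz): `(⟪b, v⟫/‖b‖)² ≤ ‖v‖²`. [this file, g94] -/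
theorem sq_inner_div_norm_le (b v : E3) : (⟪b, v⟫ / ‖b‖) ^ 2 ≤ ‖v‖ ^ 2 := by
  by_cases hb : b = 0
  · simp [hb]
  have hnb : 0 < ‖b‖ := norm_pos_iff.2 hb
  have hcs := abs_real_inner_le_norm b v
  have hsq : (⟪b, v⟫ / ‖b‖) ^ 2 = |⟪b, v⟫| ^ 2 / ‖b‖ ^ 2 := by rw [div_pow, sq_abs]
  rw [hsq, div_le_iff₀ (pow_pos hnb 2)]
  calc |⟪b, v⟫| ^ 2 ≤ (‖b‖ * ‖v‖) ^ 2 := pow_le_pow_left₀ (abs_nonneg _) hcs 2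
    _ = ‖v‖ ^ 2 * ‖b‖ ^ 2 := by ring

/-- ★ **A STRETCHED CONVEX BOND IS HARMONICALLY STABLE IN EVERY DIRECTION (PROVED)**: `1 ≤ ‖b‖` and `‖b‖⁶ < 13/7` give `0 ≤ bondHess b v` for all `v` (both
coefficients are nonnegative).  By the sign table (ZZZYJ-2) this covers every nearest-neighbour-type soft bond of length in `[1, 1.10005]`; the COMPRESSED ones
(`[0.806, 1)`, transverse coefficient `< 0`) are where (HSᴸ) needs the clamped rim (a Korn-type mechanism), the far ones (`V'' < 0`) where it needs the
nearest-neighbour stiffness to dominate. [this file, g94] -/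
theorem bondHess_nonneg_of_stretched {b : E3} (h1 : 1 ≤ ‖b‖) (h2 : ‖b‖ ^ 6 < 13 / 7) (v : E3) : 0 ≤ bondHess b v := by
  have hnb : 0 < ‖b‖ := by linarith
  have hA := sq_inner_div_norm_le b v
  have hV2 : 0 < ljSecondDeriv ‖b‖ := ljSecondDeriv_pos hnb h2
  have hV1 : 0 ≤ ljDeriv ‖b‖ := by
    rcases h1.eq_or_lt with e | hlt
    · rw [← e]; norm_num [ljDeriv]
    · exact (ljDeriv_pos_of_one_lt hlt).le
  unfold bondHess
  exact add_nonneg (mul_nonneg hV2.le (sq_nonneg _)) (mul_nonneg (div_nonneg hV1 hnb.le) (sub_nonneg.2 hA))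

/-- on a compressed bond the form is bounded below by its longitudinal part minus the pre-stress penalty on the FULL length:
`bondHess b v ≥ V''(ℓ)(u·v)² + (V'(ℓ)/ℓ)‖v‖²` when `V'(ℓ) ≤ 0` (the transverse part is at most `‖v‖²`). [this file, g94] -/
theorem bondHess_ge_of_compressed {b : E3} (hb : b ≠ 0) (hV1 : ljDeriv ‖b‖ ≤ 0) (v : E3) :
    ljSecondDeriv ‖b‖ * (⟪b, v⟫ / ‖b‖) ^ 2 + ljDeriv ‖b‖ / ‖b‖ * ‖v‖ ^ 2 ≤ bondHess b v := by
  have hnb : 0 < ‖b‖ := norm_pos_iff.2 hb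
  have ht : ljDeriv ‖b‖ / ‖b‖ ≤ 0 := div_nonpos_of_nonpos_of_nonneg hV1 hnb.le
  unfold bondHess
  nlinarith [sq_nonneg (⟪b, v⟫ / ‖b‖), mul_nonneg_of_nonpos_of_nonpos ht (neg_nonpos.2 (sq_nonneg (⟪b, v⟫ / ‖b‖)))]

/-- ★ **`clampedHessForm X z w` — THE CLAMPED (PRE-STRESSED) HESSIAN QUADRATIC FORM of `clampedEnergy X` at the configuration `z : Fin n → E3`, direction `w`**:
half the double sum over ordered pairs `i ≠ j` of `bondHess (z i − z j) (w i − w j)` (the interaction energy counts unordered pairs) plus the sum over `i` and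
the frozen exterior atoms `q ∈ X` of `bondHess (z i − q) (w i)`.  For a collision-free `z` at positive distance from `X` it is the second derivative at `0` of
`t ↦ clampedEnergy X (z + t•w)` ((C2ᴸ) asserts exactly this along soft chords).  It is the quadratic form of the matrix «H» of CRITIC-LEDGER row 1643 (c):
bondwise LONGITUDINAL STIFFNESS `V''` plus TRANSVERSE PRE-STRESS `V'/ℓ` — compressed nearest-neighbour bonds contribute NEGATIVE transverse terms (local star
forms are indefinite under compression; only the clamped rim restores positivity). [this file, g94] -/
def clampedHessForm (X : Set E3) {n : ℕ} (z w : Fin n → E3) : ℝ :=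
  (1 / 2) * (∑ i, ∑ j, if i = j then 0 else bondHess (z i - z j) (w i - w j)) + ∑ i, ∑' q : X, bondHess (z i - (q : E3)) (w i)

/-- the clamped Hessian form of the empty configuration vanishes. [formal bookkeeping] -/
theorem clampedHessForm_fin_zero (X : Set E3) (z w : Fin 0 → E3) : clampedHessForm X z w = 0 := by
  simp [clampedHessForm]

end SecondOrder

/-! ### ZZZYJ-2  (W) WINDOW-PIN (PROVED from the tree): label pairs are `σ`-separated and nearest-neighbour-type `≤ 17/16 + 2·10⁻⁴` or far `≥ 6/5`; no bond of
an inner-tube filling or of a soft competitor sits at the inflection — the sign table of the soft cone -/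

section Window

/-- every site of the placed crystal of a `σ`-separated (`σ > 2·10⁻⁴`) model two-sidedly `(10⁻⁴, 5)`-shadowed by a CLEAN `H` is `(1/15, 8999/10000, 1)`-good
in the placed crystal (tree ZZZYA `layeredHom_good_of_shadow_sigma` at the model, transported by tree ZZZNA `isTwoShellGoodSet_placed`; the `σ = 17/20` case is
tree `placedCrystal_good`). [tree ZZZYA + ZZZNA, assembled g94] -/
theorem placedCrystal_good_sigma {σ : ℝ} (hσ : 2 * (1 / 10000 : ℝ) < σ) {H : Set E3} (hH : IsClean (μS H)) {L' : E3 →L[ℝ] E3} {w' : ℤ → E3}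
    (U : E3 ≃ₗᵢ[ℝ] E3) (t : E3) (hsep : IsSep σ (LayeredHom L' w'))
    (hsh : ∀ x' ∈ LayeredHom L' w', ∃ x ∈ H, EnvClose (1 / 10000) 5 (LayeredHom L' w') x' H x) :
    ∀ c ∈ placedCrystal L' w' U t, IsTwoShellGoodSet (1 / 15) (8999 / 10000) 1 (placedCrystal L' w' U t) c := by
  intro c hc
  have hx' : U (c - t) ∈ LayeredHom L' w' := hc
  have hg := isTwoShellGoodSet_placed U t (layeredHom_good_of_shadow_sigma hσ hH hsep hsh _ hx')
  have e : U.symm (U (c - t)) + t = c := by simp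
  rw [e] at hg
  exact hg

/-- `6/5 ≤ (√2 − 1/15)·(8999/10000)` (`≈ 1.2126`): the far window of the `(1/15, 8999/10000, 1)` pattern starts above `6/5`. [numeric bookkeeping] -/
theorem six_fifths_le_far_window : (6 / 5 : ℝ) ≤ (Real.sqrt 2 - 1 / 15) * (8999 / 10000) := by
  have h14 : (141 / 100 : ℝ) ≤ Real.sqrt 2 := by
    rw [show (141 / 100 : ℝ) = Real.sqrt ((141 / 100) ^ 2) from (Real.sqrt_sq (by norm_num)).symm]
    exact Real.sqrt_le_sqrt (by norm_num)
  nlinarith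

/-- ★ **THE CRYSTAL PAIR DICHOTOMY (PROVED)**: two distinct sites of the placed crystal of a cool shadow crystal (`σ > 2·10⁻⁴`, record shadow radii
`(ϑr, Rs) = (10⁻⁴, 5)`, CLEAN chart crystal `H`) are `σ`-separated and EITHER a nearest-neighbour-type pair `dist ≤ 17/16 + 2·10⁻⁴` (tree `placedCrystal_gap`)
OR far, `6/5 ≤ dist` (gap exclusion `not_isTwoShellGoodSet_of_gap` at the `(1/15, 8999/10000, 1)` window: no pair in `(16/15, 1.2126)`). [this file, g94] -/
theorem placedCrystal_pair_dichotomy {σ ε r rI ℓ : ℝ} {S K H : Set E3} {L' : E3 →L[ℝ] E3} {w' : ℤ → E3} {U : E3 ≃ₗᵢ[ℝ] E3} {t : E3}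
    (hσ : 2 * (1 / 10000 : ℝ) < σ) (hcl : IsClean (μS H)) (hcr : IsCoolShadowCrystal σ (1 / 10000) 5 ε r rI ℓ S K H L' w' U t)
    {c c' : E3} (hc : c ∈ placedCrystal L' w' U t) (hc' : c' ∈ placedCrystal L' w' U t) (hne : c ≠ c') :
    σ ≤ dist c c' ∧ (dist c c' ≤ 17 / 16 + 2 * (1 / 10000) ∨ 6 / 5 ≤ dist c c') := by
  refine ⟨isSep_placedCrystal U t hcr.2.1 c hc c' hc' hne, ?_⟩
  by_cases h : dist c c' ≤ 28 / 25
  · exact Or.inl (placedCrystal_gap hcl hcr (by norm_num) (by norm_num) hc hc' h)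
  · right
    by_contra hlt
    rw [not_le] at h hlt
    have hgood := placedCrystal_good_sigma hσ hcl U t hcr.2.1 hcr.2.2.1 c hc
    have h₁ : (1 + 1 / 15) * (1 : ℝ) < dist c' c := by rw [dist_comm]; linarith
    have h₂ : dist c' c < (Real.sqrt 2 - 1 / 15) * (8999 / 10000) := by rw [dist_comm]; linarith [six_fifths_le_far_window]
    exact not_isTwoShellGoodSet_of_gap (by norm_num) (by norm_num) hc' (Ne.symm hne) h₁ h₂ hgood

/-- ★★ **THE LABEL PAIR DICHOTOMY (PROVED) — WINDOW-PIN.**  Under the docket's crystal and label binders (`σ > 2·10⁻⁴`, record shadow radii, CLEAN chart crystal,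
core radius `ρ < ℓ` = label zone) the labels of two distinct core atoms are DISTINCT crystal sites, hence `σ`-separated and EITHER nearest-neighbour-type
(`≤ 17/16 + 2·10⁻⁴ = 1.0627`) OR far (`≥ 6/5`).  Consequences for the sign structure of the clamped Hessian: COMPRESSED label pairs (`< 1`) are
nearest-neighbour-type; NO label pair lies in `(1.0627, 1.2)` ∋ `r⋆ ≈ 1.1087`.  Per-bond stretch up to `17/16` IS admissible (a `6.25 %` uniaxial stretch along
one bond direction is clean and Nash); only the MEAN stretch is pinned lower by the second shell (desk: `≲ 1.044`). [this file, g94] -/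
theorem label_pair_dichotomy {σ ε r rI ℓ rΘ ρ : ℝ} {S K H : Set E3} {L' : E3 →L[ℝ] E3} {w' : ℤ → E3} {U : E3 ≃ₗᵢ[ℝ] E3} {t : E3}
    (hσ : 2 * (1 / 10000 : ℝ) < σ) (hcl : IsClean (μS H)) (hcr : IsCoolShadowCrystal σ (1 / 10000) 5 ε r rI ℓ S K H L' w' U t)
    {lab : E3 → E3} (hlab : IsBondLabel ε rΘ ℓ S K (placedCrystal L' w' U t) lab) (hρℓ : ρ < ℓ)
    {n : ℕ} {xf : Fin n → E3} (hxf : Function.Injective xf) (hrange : Set.range xf = coreOf S K ρ) {i j : Fin n} (hij : i ≠ j) :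
    σ ≤ dist (lab (xf i)) (lab (xf j)) ∧
      (dist (lab (xf i)) (lab (xf j)) ≤ 17 / 16 + 2 * (1 / 10000) ∨ 6 / 5 ≤ dist (lab (xf i)) (lab (xf j))) := by
  have hcore : ∀ k, xf k ∈ coreOf S K ρ := fun k => hrange ▸ Set.mem_range_self k
  have hS : ∀ k, xf k ∈ S := fun k => (hcore k).1
  have hz : ∀ k, ∃ k' ∈ K, dist (xf k) k' < ℓ := fun k => by
    obtain ⟨k', hk', hd⟩ := (hcore k).2
    exact ⟨k', hk', by linarith⟩
  have hne : lab (xf i) ≠ lab (xf j) := hlab.ne (hS i) (hS j) (hz i) (hz j) (fun e => hij (hxf e))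
  exact placedCrystal_pair_dichotomy hσ hcl hcr (hlab.1 _ (hS i) (hz i)) (hlab.1 _ (hS j) (hz j)) hne

variable {n : ℕ}

/-- a bond of a tube member deviates in LENGTH from its label bond by at most the bond radius. [this file, g94] -/
theorem abs_norm_sub_norm_le_of_mem_bondTube {X : Set E3} {Rg sb dI dB : ℝ} {y₀ y : Fin n → E3} (hy : y ∈ bondTube X Rg sb dI dB y₀) {i j : Fin n}
    (hRg : dist (y₀ i) (y₀ j) ≤ Rg) : |‖y j - y i‖ - ‖y₀ j - y₀ i‖| ≤ sb := by
  have h := hy.1 j i (by rwa [dist_comm] at hRg)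
  rw [dist_eq_norm] at h
  exact (abs_norm_sub_norm_le _ _).trans h

/-- a bond of a `τ`-soft configuration deviates in LENGTH from the corresponding bond of the filling by at most `τ` (the witness rotation is an isometry). -/
theorem abs_norm_sub_norm_le_of_isSoftAbout {Rd τ : ℝ} {y₀ y z : Fin n → E3} (h : IsSoftAbout Rd τ y₀ y z) {i j : Fin n}
    (hRd : dist (y₀ i) (y₀ j) ≤ Rd) : |‖z j - z i‖ - ‖y j - y i‖| ≤ τ := by
  obtain ⟨V, _, hb⟩ := h
  have h1 := hb i j hRd
  have e : ‖V i (y j - y i)‖ = ‖y j - y i‖ := (V i).norm_map _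
  rw [← e]
  exact (abs_norm_sub_norm_le _ _).trans h1

/-- ★★ **THE SOFT BOND DICHOTOMY (PROVED)**: for a filling `y` of the inner tube (bond radius `sb₁`) about the labels `y₀ = lab ∘ xf` and a configuration `z`
that is `τ`-soft about `y` at range `Rd`, every label pair `i ≠ j` within both ranges has `σ − sb₁ − τ ≤ ‖z j − z i‖` and EITHER
`‖z j − z i‖ ≤ 17/16 + 2·10⁻⁴ + sb₁ + τ` (nearest-neighbour type) OR `6/5 − sb₁ − τ ≤ ‖z j − z i‖` (far type).  (With `z = y`, `τ = 0`: the filling's own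
bond windows.) [this file, g94] -/
theorem soft_bond_dichotomy {σ ε r rI ℓ rΘ ρ Rg Rd sb₁ dI₁ dB₁ τ : ℝ} {S K H : Set E3} {X : Set E3} {L' : E3 →L[ℝ] E3} {w' : ℤ → E3}
    {U : E3 ≃ₗᵢ[ℝ] E3} {t : E3} (hσ : 2 * (1 / 10000 : ℝ) < σ) (hcl : IsClean (μS H))
    (hcr : IsCoolShadowCrystal σ (1 / 10000) 5 ε r rI ℓ S K H L' w' U t) {lab : E3 → E3}
    (hlab : IsBondLabel ε rΘ ℓ S K (placedCrystal L' w' U t) lab) (hρℓ : ρ < ℓ) {xf : Fin n → E3} (hxf : Function.Injective xf)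
    (hrange : Set.range xf = coreOf S K ρ) {y z : Fin n → E3} (hy : y ∈ bondTube X Rg sb₁ dI₁ dB₁ (fun i => lab (xf i)))
    (hsoft : IsSoftAbout Rd τ (fun i => lab (xf i)) y z) {i j : Fin n} (hij : i ≠ j) (hRg : dist (lab (xf i)) (lab (xf j)) ≤ Rg)
    (hRd : dist (lab (xf i)) (lab (xf j)) ≤ Rd) :
    σ - sb₁ - τ ≤ ‖z j - z i‖ ∧ (‖z j - z i‖ ≤ 17 / 16 + 2 * (1 / 10000) + sb₁ + τ ∨ 6 / 5 - sb₁ - τ ≤ ‖z j - z i‖) := by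
  have hlab2 := label_pair_dichotomy hσ hcl hcr hlab hρℓ hxf hrange hij
  have hyb := abs_le.1 (abs_norm_sub_norm_le_of_mem_bondTube hy hRg)
  have hzb := abs_le.1 (abs_norm_sub_norm_le_of_isSoftAbout hsoft hRd)
  have e : dist (lab (xf i)) (lab (xf j)) = ‖lab (xf j) - lab (xf i)‖ := by rw [dist_comm, dist_eq_norm]
  rw [e] at hlab2
  obtain ⟨hsep, hdich⟩ := hlab2
  refine ⟨by linarith [hyb.1, hzb.1], ?_⟩
  rcases hdich with hnn | hfar
  · exact Or.inl (by linarith [hyb.2, hzb.2])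
  · exact Or.inr (by linarith [hyb.1, hzb.1])

/-- ★★ **THE SIGN TABLE OF THE SOFT CONE AT THE RECORD (PROVED)**: at `σ = 27/32`, `sb₁ ≤ 249/20000`, `τ = 249/10000` a nearest-neighbour-type soft bond has
length in `[0.806, 1.10005]`, strictly on the CONVEX side of the inflection (`V'' > 0`: `1.10005⁶ ≈ 1.772 < 13/7`); a far-type one has length `≥ 1.16265`,
strictly on the CONCAVE and TENSILE side (`V' > 0`, `V'' < 0`: `1.16265⁶ ≈ 2.47 > 13/7`).  Hence the only negative entries of the clamped Hessian on the soft
cone are the TRANSVERSE pre-stress of COMPRESSED nearest-neighbour bonds and the LONGITUDINAL softening of far bonds — the two enemies (HSᴸ) must beat.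
(g92/g93's feared isotropic corner `ℓ_NN ≈ 1.075–1.08` would need ALL twelve bonds of a site beyond `17/16`; WINDOW-PIN admits `17/16` per bond only.) -/
theorem soft_bond_sign_record (l : ℝ) :
    (27 / 32 - 249 / 20000 - 249 / 10000 ≤ l → l ≤ 17 / 16 + 2 * (1 / 10000) + 249 / 20000 + 249 / 10000 → 0 < ljSecondDeriv l) ∧
      (6 / 5 - 249 / 20000 - 249 / 10000 ≤ l → 0 < ljDeriv l ∧ ljSecondDeriv l < 0) := by
  refine ⟨fun hlo hhi => ?_, fun hlo => ⟨ljDeriv_pos_of_one_lt (by linarith), ?_⟩⟩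
  · have hl : 0 < l := by linarith
    refine ljSecondDeriv_pos hl ?_
    calc l ^ 6 ≤ (17 / 16 + 2 * (1 / 10000) + 249 / 20000 + 249 / 10000) ^ 6 := pow_le_pow_left₀ hl.le hhi 6
      _ < 13 / 7 := by norm_num
  · have hl : 0 < l := by linarith
    refine ljSecondDeriv_neg hl ?_
    calc (13 / 7 : ℝ) < (6 / 5 - 249 / 20000 - 249 / 10000) ^ 6 := by norm_num
      _ ≤ l ^ 6 := pow_le_pow_left₀ (by norm_num) hlo 6

end Window

end Summit.AtomisticToContinuum.Crystallization.Theorems.ChartedZeroExcessLayeredLatticeLiouville
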